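import Summits.BirchSwinnertonDyer.BirchSwinnertonDyer.Theorems.RamifiedSevenEllipticUnitsStrictControlAnyPrime
import Summits.BirchSwinnertonDyer.Rank1Residual.X12.O11.RouteUSelmerSha
import Summits.BirchSwinnertonDyer.Rank1Residual.X12.O11.RouteUModelsA
import Summits.BirchSwinnertonDyer.Rank1Residual.X12.O11.RouteUTwistCM
import Summits.BirchSwinnertonDyer.Rank1Residual.X12.O11.RouteUSevenUnitCase
import Literature.NumberTheory.EllipticCurves.RationalPointInfiniteOrderCriteria
import HarnessLib

set_option linter.dupNamespace false
set_option autoImplicit false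

/-!
# Route `RamifiedSevenEllipticUnits` (rung K7r), crux `StrictTorsionSeven` (stmt-BirchSwinnertonDyer-19144):
# (R-tors) at a MEMBER from a finite `p`-descent certificate — the named fact GZK replaced, curve by
# curve, by two `p`-Selmer cardinalities and two points of infinite order

Cell `bsd-cm`, seat `bsd-cm-k7r-c3` (g5). HONEST FRAMING: BSD is not proved by any of this; the CLASS
statement `StrictTorsionSeven` ((R-tors)@7 on the infinite class 𝒞₇) is untouched — it is equivalent to
the finiteness of `Sel_str(W/ℚ)[7^∞]` for every globally minimal `W ∈ 𝒞₇`
(`strictTorsionSeven_iff_finite_strictSelmerPInfty`, p431290) and follows from the named Literature fact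
GZK (`strictTorsionSeven_of_GZK`, p430232; the route's twin `StrictTorsionSevenOfGZK`). THIS FILE proves
the complementary PER-MEMBER statement with NO named fact: the typed O11 input
`X12.O11.RamifiedCMStrictTorsionAt W p` — at every analytic-rank-one frame of `(W, p)` the strict
anticyclotomic Selmer dual at the ramified prime is `Λ`-torsion with `f(0) ≠ 0` and `X[T]` finite —
holds for ONE globally minimal `W/ℚ` as soon as

* (d)  `#Sel^{(p)}(W/ℚ) ∣ p` and `W(ℚ)` has a point of infinite order, and
* (d') the same for ONE model `V` of the CM twist `W^{(d_K)}` (`d_K = cmFieldDiscrOfJ W.j`; every frame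
  twin `W'` is `ℚ`-isomorphic to `V`).

These are FINITE data: a `p`-descent (for the 𝒞₇ frames at `p = 7`: the two isogeny-Selmer dimensions
`dim Sel^φ(W/ℚ)`, `dim Sel^φ̂(W'/ℚ)` of the `7`-isogeny `φ : W → W'`, which bound BOTH `#Sel⁷(W)` and
`#Sel⁷(W')` — seat k7r-c2's two-engine certificates, kit j250795 / j250884, evidence on
stmt-BirchSwinnertonDyer-19143) and two rational points certified non-torsion by Lutz–Nagell
(`not_isOfFinAddOrder_of_dvd_den`). In a per-member file they enter as DISPLAYED binders (certified
datum), exactly as Route U's (U-D) `RouteU.SelmerSevenBound W`; nothing is asserted about any curve here.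

THE ALGEBRA (§1, any elliptic `W/ℚ`, any prime `p`): `#Sel^{(p)} = p^{rank} · #W(ℚ)[p] · #Ш[p]`
(Silverman X.4.2, tree `natCard_selmerGroup_eq`), so `#Sel^{(p)} ∣ p` forces `rank ≤ 1`; a point of
infinite order forces `rank ≥ 1`; then `#Sel^{(p)} = p` and the fundamental exact sequence kills `Ш[p]`
(`RouteU.sha_noPTorsion_of_card_selmerGroup_dvd`), hence `Ш[p^∞] = 0`, and in rank one with finite
`Ш[p^∞]` the strict Selmer group `Sel_str(W/ℚ)[p^∞]` is finite (Skinner 2020 §2.2, tree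
`finite_strictSelmerPInfty_of_mordellWeilRank_eq_one`). §2 transports this to every O11 frame through the
unconditional twist-descent count (D♮)_p (`finite_selmerAcBase_frame_iff_prime`) and the
`ℚ`-isomorphism invariance of `#Sel_str` (`natCard_strictSelmerPInfty_eq_of_variableChange`); §3 feeds the
seat's g0 reduction `ramifiedCMStrictTorsionAt_of_noPTorsion_of_finite_base` with the two local inputs
(A𝔭), (Av) discharged at every frame by k7r-c4 (`noPTorsion_adicCompletion_of_isFrame`,
`good_or_noPTorsion_of_isFrame`). No analytic rank, no `L`-function, no Euler system enters. §4 is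
the RUNG at `D = −11`: for `W = 5929e1 = [1, −1, 1, −265, 2104]` and its frame twin
`W' = [1, −1, 1, −12970, −695824]` (minimal model of the tree's twist `W^{(−7)}`, change of variables
`[1, −2, 1/2, 1/2]`, kit j254704, re-checked by `norm_num`), the two rank inputs are kernel facts
(Lutz–Nagell points `3·(−8, 64)` and `2·(1994, 87877)`), so `X12.O11.RamifiedCMStrictTorsionAt 5929e1 7`
holds GRANTED ONLY the two displayed `7`-Selmer cardinalities `RouteU.SelmerSevenBound W`,
`RouteU.SelmerSevenBound W'` (certified datum: k7r-c2's `7`-isogeny descent, kit j250795 engine A /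
j250884 engine B, row `D = −11`: `dim Sel^φ(W/ℚ) = 0`, `dim Sel^φ̂(W'/ℚ) = 1`, whence `#Sel⁷ ≤ 7` on both
sides by `Sel^φ → Sel⁷ → Sel^φ̂`).

PARTITION (D-0054): CornerF-ramified (B13/O11) × any framed CM pair `(W, p)`, in particular 𝒞₇ × 7 —
types-the-object-of (per-member certificate consumer for crux #3; closes no cell, no item).
References: [SilvermanAEC2009] Thm. X.4.2, VII.3.4, VIII.6.7; [Skinner2020] §2.2; [GreenbergLNM1716] §3
Lemmas 3.1–3.3, §4 Lemma 4.2; [DokchitserDokchitserAnnals2010] Lemma 4.14 (proof); [Castella2018] Def. 2.2.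
-/

noncomputable section

open scoped Classical

open WeierstrassCurve NumberField IsDedekindDomain Field
  Literature.NumberTheory.EllipticCurves
  Literature.NumberTheory.EllipticCurves.Rank1Residual
  Summit.BirchSwinnertonDyer.Rank1Residual
  Summit.BirchSwinnertonDyer.Rank1Residual.Additive
  Summit.BirchSwinnertonDyer.Rank1Residual.X11b
  Summit.BirchSwinnertonDyer.Rank1Residual.X11b.AcSelmer

namespace Summit.BirchSwinnertonDyer.BirchSwinnertonDyer.Theorems.RamifiedSevenEllipticUnits

/-! ## §1 `p`-descent algebra over `ℚ`: `#Sel^{(p)} ∣ p` and a point of infinite order -/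

section Descent

variable (W : WeierstrassCurve ℚ) [W.IsElliptic] (p : ℕ) [Fact p.Prime]

/-- **`#Sel^{(p)}(W/ℚ) ∣ p ⟹ rank W(ℚ) ≤ 1`**: `p^{rank} ∣ #Sel^{(p)}` by the descent count
`#Sel^{(p)} = p^{rank} · #W(ℚ)[p] · #Ш[p]`. [cite: SilvermanAEC2009, Thm. X.4.2] -/
theorem mordellWeilRank_le_one_of_card_selmerGroup_dvd (hdvd : Nat.card (W.selmerGroup p) ∣ p) :
    W.mordellWeilRank ≤ 1 := by
  have hp : p.Prime := Fact.out
  have hcount := W.natCard_selmerGroup_eq (n := p) hp.ne_zero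
  have hpow : p ^ W.mordellWeilRank ∣ p ^ 1 := by
    rw [pow_one]
    refine dvd_trans ?_ hdvd
    rw [hcount, mul_assoc]
    exact dvd_mul_right _ _
  exact (Nat.pow_dvd_pow_iff_le_right hp.one_lt).mp hpow

/-- **`#Sel^{(p)}(W/ℚ) ∣ p` and `rank W(ℚ) ≥ 1 ⟹ rank W(ℚ) = 1`.** [cite: SilvermanAEC2009, Thm. X.4.2] -/
theorem mordellWeilRank_eq_one_of_card_selmerGroup_dvd (hdvd : Nat.card (W.selmerGroup p) ∣ p)
    (hr : 1 ≤ W.mordellWeilRank) : W.mordellWeilRank = 1 :=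
  le_antisymm (mordellWeilRank_le_one_of_card_selmerGroup_dvd W p hdvd) hr

/-- **… ⟹ `Ш(W/ℚ)[p] = 0`**: in rank one `#Sel^{(p)} = p = #(W(ℚ)/pW(ℚ))`, so the fundamental exact
sequence leaves no room for `Ш[p]` (Route U's `sha_noPTorsion_of_card_selmerGroup_dvd`).
[cite: SilvermanAEC2009, Thm. X.4.2] -/
theorem sha_noPTorsion_of_card_selmerGroup_dvd_of_rank (hdvd : Nat.card (W.selmerGroup p) ∣ p)
    (hr : 1 ≤ W.mordellWeilRank) : ∀ x : W.sha, (p : ℤ) • x = 0 → x = 0 :=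
  X12.O11.RouteU.sha_noPTorsion_of_card_selmerGroup_dvd W p
    (mordellWeilRank_eq_one_of_card_selmerGroup_dvd W p hdvd hr) hdvd

/-- In an abelian group without elements of order `p` the `p`-primary component is trivial
(`p^n • x = 0 ⟹ x = 0` by induction on `n`). [folklore] -/
theorem primaryComponent_eq_bot_of_noPTorsion {A : Type*} [AddCommGroup A] (q : ℕ) [Fact q.Prime]
    (h : ∀ x : A, (q : ℤ) • x = 0 → x = 0) : AddCommGroup.primaryComponent A q = ⊥ := by
  have key : ∀ (n : ℕ) (x : A), q ^ n • x = 0 → x = 0 := by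
    intro n
    induction n with
    | zero =>
      intro x hx
      simpa using hx
    | succ n ih =>
      intro x hx
      refine ih x (h _ ?_)
      rw [natCast_zsmul, smul_smul, ← pow_succ', hx]
  rw [eq_bot_iff]
  intro x hx
  obtain ⟨n, hn⟩ := (AddCommGroup.mem_primaryComponent).mp hx
  rw [AddSubgroup.mem_bot]
  exact key n x hn

/-- **… ⟹ `Ш(W/ℚ)[p^∞] = 0`.** [cite: SilvermanAEC2009, Thm. X.4.2] -/
theorem sha_primaryComponent_eq_bot_of_card_selmerGroup_dvd (hdvd : Nat.card (W.selmerGroup p) ∣ p)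
    (hr : 1 ≤ W.mordellWeilRank) : AddCommGroup.primaryComponent W.sha p = ⊥ :=
  primaryComponent_eq_bot_of_noPTorsion p (sha_noPTorsion_of_card_selmerGroup_dvd_of_rank W p hdvd hr)

/-- **`#Sel^{(p)}(W/ℚ) ∣ p` and `rank W(ℚ) ≥ 1 ⟹ Sel_str(W/ℚ)[p^∞]` is finite** — rank one and
`Ш[p^∞] = 0` by the descent count, then Skinner's rank-one lemma
(`finite_strictSelmerPInfty_of_mordellWeilRank_eq_one`). NO analytic input, NO named fact.
[cite: SilvermanAEC2009, Thm. X.4.2] [cite: Skinner2020, §2.2 (Lemma rank1lemma) and §3] -/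
theorem finite_strictSelmerPInfty_of_card_selmerGroup_dvd (hdvd : Nat.card (W.selmerGroup p) ∣ p)
    (hr : 1 ≤ W.mordellWeilRank) : Finite ↥(strictSelmerPInfty W p) := by
  have hrank := mordellWeilRank_eq_one_of_card_selmerGroup_dvd W p hdvd hr
  have hbot := sha_primaryComponent_eq_bot_of_card_selmerGroup_dvd W p hdvd hr
  haveI : Finite (AddCommGroup.primaryComponent W.sha p) := by
    rw [hbot]
    infer_instance
  exact finite_strictSelmerPInfty_of_mordellWeilRank_eq_one W p hrank

end Descent

/-! ## §2 Transport to every O11 frame -/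

section Frame

variable (p : ℕ) [Fact p.Prime]

/-- `ℚ`-isomorphic curves have strict `p^∞`-Selmer groups of the same order, so finiteness transports
along `C • V = W'`. [cite: SilvermanAEC2009, X.§4 (Remark 4.1.1)] -/
theorem finite_strictSelmerPInfty_of_variableChange {V W' : WeierstrassCurve ℚ} [V.IsElliptic]
    [W'.IsElliptic] {C : VariableChange ℚ} (hC : C • V = W') [hV : Finite ↥(strictSelmerPInfty V p)] :
    Finite ↥(strictSelmerPInfty W' p) := by
  refine Nat.finite_of_card_ne_zero ?_
  rw [← natCard_strictSelmerPInfty_eq_of_variableChange p hC]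
  exact Nat.card_pos.ne'

variable (W : WeierstrassCurve ℚ) [W.IsElliptic]

/-- **(F)_p at a frame from descent data, no named fact.** For `W/ℚ` elliptic with `#Sel^{(p)}(W/ℚ) ∣ p`
and `rank W(ℚ) ≥ 1`, and ONE model `V` of the CM twist `W^{(d_K)}` (`CV • W^{(d_K)} = V`,
`d_K = cmFieldDiscrOfJ W.j`) with `#Sel^{(p)}(V/ℚ) ∣ p` and `rank V(ℚ) ≥ 1`: at every O11 frame
`(K, 𝔭, W', C)` of `(W, p)`, Castella's strict Selmer group `Sel_𝔭(K, W[p^∞])` over the CM field is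
finite — by §1 for `W` and `V`, the isomorphism `W' = (C·CV⁻¹) • V`, and the unconditional count
(D♮)_p `#Sel_𝔭(K, W[p^∞]) = #Sel_str(W/ℚ)[p^∞] · #Sel_str(W'/ℚ)[p^∞]`.
[cite: DokchitserDokchitserAnnals2010, Lemma 4.14 (proof)] [cite: Castella2018, Def. 2.2 (arXiv:1704.06608 p. 5)] -/
theorem finite_selmerAcBase_frame_of_card_selmerGroup_dvd
    (hdvd : Nat.card (W.selmerGroup p) ∣ p) (hr : 1 ≤ W.mordellWeilRank)
    {V : WeierstrassCurve ℚ} [V.IsElliptic] {CV : VariableChange ℚ}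
    (hV : CV • W.quadraticTwist ((cmFieldDiscrOfJ W.j : ℤ) : ℚ) = V)
    (hdvdV : Nat.card (V.selmerGroup p) ∣ p) (hrV : 1 ≤ V.mordellWeilRank)
    {K : Type} [Field K] [NumberField K] {𝔭 : HeightOneSpectrum (𝓞 K)}
    {W' : WeierstrassCurve ℚ} [W'.IsElliptic] {C : VariableChange ℚ}
    (hF : X12.O11.IsFrame W p K 𝔭 W' C) :
    Finite (selmerAcBase (W.baseChange K) p 𝔭 ∅) := by
  haveI := finite_strictSelmerPInfty_of_card_selmerGroup_dvd W p hdvd hr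
  haveI := finite_strictSelmerPInfty_of_card_selmerGroup_dvd V p hdvdV hrV
  have hW' : (C * CV⁻¹) • V = W' := by
    rw [mul_smul, ← hV, inv_smul_smul]
    exact hF.2.2.2.2.2.2
  haveI := finite_strictSelmerPInfty_of_variableChange p hW'
  exact (finite_selmerAcBase_frame_iff_prime W p K 𝔭 W' C hF).mpr ⟨inferInstance, inferInstance⟩

end Frame

/-! ## §3 Crux #3's typed input at a member, from the descent certificate alone -/

section Member

variable (W : WeierstrassCurve ℚ) [W.IsElliptic] [W.IsGloballyMinimal] (p : ℕ) [Fact p.Prime]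

/-- **(R-tors)@`p` AT A MEMBER, NO NAMED FACT.** Let `W/ℚ` be globally minimal with `#Sel^{(p)}(W/ℚ) ∣ p`
and `rank W(ℚ) ≥ 1`, and let `V` be a model of the CM twist `W^{(d_K)}` with `#Sel^{(p)}(V/ℚ) ∣ p` and
`rank V(ℚ) ≥ 1`. Then O11's typed input `X12.O11.RamifiedCMStrictTorsionAt W p` holds: at every
analytic-rank-one O11 frame of `(W, p)` and every anticyclotomic `ℤ_p`-tower, the strict anticyclotomic
Selmer dual `X` at the ramified prime is `Λ`-torsion with `ord_p f(0) = n₀` for some `n₀` and `X[T]`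
finite. Proof: §2 gives (F)_p at every frame; the two local inputs (A𝔭) `W(K_𝔭)[p] = 0` and (Av) are
theorems at every frame (`noPTorsion_adicCompletion_of_isFrame`, `good_or_noPTorsion_of_isFrame`); the
seat's reduction `ramifiedCMStrictTorsionAt_of_noPTorsion_of_finite_base` (exact control + Euler
characteristic + Greenberg's criterion on the dual pair) concludes. The class twin needs GZK only to
produce these finiteness inputs on the INFINITE class; at a member a finite `p`-descent does it.
[cite: SilvermanAEC2009, Thm. X.4.2] [cite: Skinner2020, §2.2]
[cite: GreenbergLNM1716, §1 p. 61, §3 Lemmas 3.1–3.3 and §4 Lemma 4.2] -/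
theorem ramifiedCMStrictTorsionAt_of_card_selmerGroup_dvd
    (hdvd : Nat.card (W.selmerGroup p) ∣ p) (hr : 1 ≤ W.mordellWeilRank)
    {V : WeierstrassCurve ℚ} [V.IsElliptic] {CV : VariableChange ℚ}
    (hV : CV • W.quadraticTwist ((cmFieldDiscrOfJ W.j : ℤ) : ℚ) = V)
    (hdvdV : Nat.card (V.selmerGroup p) ∣ p) (hrV : 1 ≤ V.mordellWeilRank) :
    X12.O11.RamifiedCMStrictTorsionAt W p :=
  ramifiedCMStrictTorsionAt_of_noPTorsion_of_finite_base W p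
    (fun _ _ _ _ _ _ _ _ hF ↦ noPTorsion_adicCompletion_of_isFrame W p hF)
    (fun _ _ _ _ _ _ _ _ hF ↦ good_or_noPTorsion_of_isFrame W p hF)
    (fun _ _ _ _ _ _ _ _ hF _ ↦
      finite_selmerAcBase_frame_of_card_selmerGroup_dvd p W hdvd hr hV hdvdV hrV hF)

/-- **Point form (Lutz–Nagell certificates).** The same with the two rank inputs supplied by rational
points `(x, y) ∈ W(ℚ)`, `(x', y') ∈ V(ℚ)` whose `x`-denominators are divisible by primes `ℓ, ℓ' ≥ 3` (instances `Fact ℓ.Prime`)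
(points of infinite order on globally minimal models, tree `not_isOfFinAddOrder_of_dvd_den`); here `V`
must be globally minimal too. One theorem call per member once the two Selmer cardinalities are
displayed (§4: `5929e1`). [cite: SilvermanAEC2009, VII.3.4, Thm. VIII.6.7 and Thm. X.4.2] [cite: Skinner2020, §2.2] -/
theorem ramifiedCMStrictTorsionAt_of_card_selmerGroup_dvd_of_dvd_den
    (hdvd : Nat.card (W.selmerGroup p) ∣ p) {ℓ : ℕ} [Fact ℓ.Prime] (hℓ : 3 ≤ ℓ) {x y : ℚ}
    (hxy : W.toAffine.Nonsingular x y) (hx : ℓ ∣ x.den)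
    {V : WeierstrassCurve ℚ} [V.IsElliptic] [V.IsGloballyMinimal] {CV : VariableChange ℚ}
    (hV : CV • W.quadraticTwist ((cmFieldDiscrOfJ W.j : ℤ) : ℚ) = V)
    (hdvdV : Nat.card (V.selmerGroup p) ∣ p) {ℓ' : ℕ} [Fact ℓ'.Prime] (hℓ' : 3 ≤ ℓ') {x' y' : ℚ}
    (hxy' : V.toAffine.Nonsingular x' y') (hx' : ℓ' ∣ x'.den) :
    X12.O11.RamifiedCMStrictTorsionAt W p :=
  ramifiedCMStrictTorsionAt_of_card_selmerGroup_dvd W p hdvd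
    (one_le_mordellWeilRank_of_dvd_den W ℓ hℓ hxy hx) hV hdvdV
    (one_le_mordellWeilRank_of_dvd_den V ℓ' hℓ' hxy' hx')

end Member


/-! ## §4 The rung at `D = −11`: `5929e1 = 49a1^{(−11)}` and its frame twin, from two `7`-Selmer
cardinalities — no named fact -/

section RungD11

/-- The frame twin of `5929e1`: `[1, −1, 1, −12970, −695824]` (the global minimal model of
`5929e1^{(−7)} = 49a3^{(−11)}`, conductor `5929`, `Δ = −7⁹·11⁶`, `j = −3375`; PARI `ellminimalmodel` of the
tree's twist model, kit j254704) is an elliptic curve. [cite: Cremona1997, Table 1 (isogeny class 5929e)] -/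
@[instance] theorem isElliptic_c5929e1twin :
    (⟨1, -1, 1, -12970, -695824⟩ : WeierstrassCurve ℚ).IsElliptic :=
  ⟨by
    rw [isUnit_iff_ne_zero]
    norm_num [WeierstrassCurve.Δ, WeierstrassCurve.b₂, WeierstrassCurve.b₄, WeierstrassCurve.b₆,
      WeierstrassCurve.b₈]⟩

/-- `[1, −1, 1, −12970, −695824]` is a GLOBAL MINIMAL model (`Δ = −71488876370527 = −7⁹·11⁶`: no prime `ℓ`
has `ℓ¹² ∣ Δ`; Silverman's integer criterion, tree `isGloballyMinimal_of_int_criterion`).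
[cite: SilvermanAEC2009, VII.1 Remark 1.1] -/
@[instance] theorem isGloballyMinimal_c5929e1twin :
    (⟨1, -1, 1, -12970, -695824⟩ : WeierstrassCurve ℚ).IsGloballyMinimal := by
  have h := Rank1Residual.X11RankOneCertificates.isGloballyMinimal_of_int_criterion 1 (-1) 1 (-12970)
    (-695824) fun q hq ⟨hΔ, _⟩ => by
      have hD : Rank1Residual.X11RankOneCertificates.discOf [1, -1, 1, -12970, -695824] =
          -71488876370527 := by
        decide +kernel
      rw [hD, dvd_neg] at hΔ
      have hle : (q : ℤ) ^ 12 ≤ 71488876370527 := Int.le_of_dvd (by norm_num) hΔ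
      have hqP : q < 15 := by
        by_contra h
        push Not at h
        have : (15 : ℤ) ^ 12 ≤ (q : ℤ) ^ 12 := by gcongr; exact_mod_cast h
        norm_num at this
        omega
      interval_cases q <;> (try norm_num at hq) <;> (try norm_num at hΔ)
  exact_mod_cast h

/-- The CM field of `5929e1` is `ℚ(√−7)`: `cmFieldDiscrOfJ j(5929e1) = −7` (`5929e1` is a model of
`49a1^{(−11)}`, `RouteU.exists_variableChange_c5929e1`; `RouteU.cmFieldDiscrOfJ_of_twist_cm7`).
[cite: SilvermanATAEC1994, App. A §3 (table of CM j-invariants)] -/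
theorem cmFieldDiscrOfJ_c5929e1 :
    cmFieldDiscrOfJ (⟨1, -1, 1, -265, 2104⟩ : WeierstrassCurve ℚ).j = -7 :=
  X12.O11.RouteU.cmFieldDiscrOfJ_of_twist_cm7 _ (D := -(11 : ℕ)) (by norm_num)
    X12.O11.RouteU.exists_variableChange_c5929e1

/-- The change of variables `[u, r, s, t] = [1, −2, 1/2, 1/2]` carries the tree's twist model
`5929e1^{(d_K)}`, `d_K = cmFieldDiscrOfJ j(5929e1) = −7` (`quadraticTwist`: `[0, d b₂/4, 0, d² b₄/2, d³ b₆/4]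
= [0, 21/4, 0, −25921/2, −2887031/4]`), to the minimal model `[1, −1, 1, −12970, −695824]` (PARI
`ellminimalmodel`, kit j254704; re-checked here by `norm_num`). [cite: Cremona1997, Table 1 (isogeny class 5929e)] -/
theorem variableChange_twist_c5929e1 :
    (⟨1, -2, 1/2, 1/2⟩ : VariableChange ℚ) •
        (⟨1, -1, 1, -265, 2104⟩ : WeierstrassCurve ℚ).quadraticTwist
          ((cmFieldDiscrOfJ (⟨1, -1, 1, -265, 2104⟩ : WeierstrassCurve ℚ).j : ℤ) : ℚ) =
      (⟨1, -1, 1, -12970, -695824⟩ : WeierstrassCurve ℚ) := by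
  rw [cmFieldDiscrOfJ_c5929e1]
  ext <;> norm_num [quadraticTwist, WeierstrassCurve.variableChange_a₁,
    WeierstrassCurve.variableChange_a₂, WeierstrassCurve.variableChange_a₃,
    WeierstrassCurve.variableChange_a₄, WeierstrassCurve.variableChange_a₆, WeierstrassCurve.b₂,
    WeierstrassCurve.b₄, WeierstrassCurve.b₆]

/-- **THE RUNG AT `D = −11` — (R-tors)@7 at `5929e1` from two `7`-Selmer cardinalities, NO named fact.**
For the globally minimal `W = 5929e1 = [1, −1, 1, −265, 2104]` (`= 49a1^{(−11)}`, the 𝒞₇ member of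
conductor `5929`) and its frame twin `W' = [1, −1, 1, −12970, −695824]`: IF `#Sel⁷(W/ℚ) ∣ 7` and
`#Sel⁷(W'/ℚ) ∣ 7` (Route U's descent input `RouteU.SelmerSevenBound`, DISPLAYED — a certified datum: the
`7`-isogeny descent `dim Sel^φ(W/ℚ) = 0`, `dim Sel^φ̂(W'/ℚ) = 1` of seat k7r-c2's two engines, kit
j250795 / j250884, calibration member `D = −11`, bounds both), THEN O11's typed input
`X12.O11.RamifiedCMStrictTorsionAt W 7` holds — at every analytic-rank-one O11 frame of `(W, 7)` and every
anticyclotomic `ℤ₇`-tower the strict Selmer dual at `𝔭 = (√−7)` is `Λ`-torsion with `f(0) ≠ 0` and finite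
`X[T]`. The two rank inputs are KERNEL facts: `3·(−8, 64) = (6616/625, 224511/15625) ∈ W(ℚ)` has `5 ∣ den x`
and `2·(1994, 87877) = (1087580259/2157961, 34010947141202/3170044709) ∈ W'(ℚ)` has `13 ∣ den x`, so both
have infinite order on their minimal models (Lutz–Nagell). Compare the class statement: the route's twin
`StrictTorsionSevenOfGZK` needs Gross–Zagier–Kolyvagin to get the same finiteness on the INFINITE class 𝒞₇.
[cite: SilvermanAEC2009, VII.3.4, Thm. VIII.6.7 and Thm. X.4.2] [cite: Skinner2020, §2.2]
[cite: GreenbergLNM1716, §3 Lemmas 3.1–3.3 and §4 Lemma 4.2] -/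
theorem ramifiedCMStrictTorsionAt_seven_c5929e1_of_selmerSevenBound
    [Fact (Nat.Prime 7)]
    (hSel : X12.O11.RouteU.SelmerSevenBound (⟨1, -1, 1, -265, 2104⟩ : WeierstrassCurve ℚ))
    (hSel' : X12.O11.RouteU.SelmerSevenBound (⟨1, -1, 1, -12970, -695824⟩ : WeierstrassCurve ℚ)) :
    X12.O11.RamifiedCMStrictTorsionAt (⟨1, -1, 1, -265, 2104⟩ : WeierstrassCurve ℚ) 7 := by
  haveI : Fact (Nat.Prime 5) := ⟨by norm_num⟩
  haveI : Fact (Nat.Prime 13) := ⟨by norm_num⟩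
  exact ramifiedCMStrictTorsionAt_of_card_selmerGroup_dvd_of_dvd_den _ 7 hSel (ℓ := 5) (by norm_num)
    (x := (6616 : ℚ) / 625) (y := (224511 : ℚ) / 15625)
    (WeierstrassCurve.Affine.equation_iff_nonsingular.mp
      ((WeierstrassCurve.Affine.equation_iff _ _).mpr (by norm_num)))
    (by decide +kernel) variableChange_twist_c5929e1 hSel' (ℓ' := 13) (by norm_num)
    (x' := (1087580259 : ℚ) / 2157961) (y' := (34010947141202 : ℚ) / 3170044709)
    (WeierstrassCurve.Affine.equation_iff_nonsingular.mp
      ((WeierstrassCurve.Affine.equation_iff _ _).mpr (by norm_num)))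
    (by decide +kernel)

end RungD11

end Summit.BirchSwinnertonDyer.BirchSwinnertonDyer.Theorems.RamifiedSevenEllipticUnits

end
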